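import Summits.NavierStokesRegularity.NavierStokesRegularity.Theorems.AxisymmetricExtremalityAxisymmetricKatoGlobalReduction
import Summits.NavierStokesRegularity.NavierStokesRegularity.Theorems.AxisymmetricExtremalityAxisymmetricKatoGlobalNoSwirlStratum
import HarnessLib

/-!
# Strategist s19-g16 — kernel-checked companion of `STRATEGY-CENSUS-s19.md`
crux `AxisymmetricKatoGlobal` (stmt-NavierStokesRegularity-15453) of
route-NavierStokesRegularity-AxisymmetricExtremality.

Contents (all sorry-free; nothing here is a proof of the crux):
* §W  `NoAxisymMinimalBlowupDatum` (W0) — the weakest statement that can replace the crux in the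
  route's deciding theorem: `closes_of_noAxisymMinimal` (re-glue, pure logic) and
  `noAxisymMinimal_of_crux` (W0 is formally weaker).
* §W' the O(2) stratum of W0 is a THEOREM of the tree: an axisymmetric field that is also
  mirror-symmetric is swirl-free (`hasNoSwirl_of_isAxisymmetric_of_isMirrorSymmetric`), hence
  `noO2MinimalBlowupDatum` from `NoSwirlStratum.hasGlobalKatoSolution_of_isAxisymmetric_hasNoSwirl_viscosity`;
  consequently the dihedral re-glue `closes_dihedral : MinimalDatumDihedralPFold → DihedralPFoldToO2 →
  NavierStokesRegularity` decides the summit WITHOUT the crux (route-level observation, not a line).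
* §D  the any-modulus decomposition D2 = (a-priori vanishing of Γ at the axis) ∧ (modulus upgrade
  to log⁻³) with PROVED assembly `crux_of_D2` through the landed reduction
  `Registered.AxisymmetricKatoGlobal_of_logSwirlFacts`.
* §S  the strengthening AX-L (Liouville for bounded ancient axisymmetric mild solutions) typed
  abstractly as a signature only (no claim).
-/

noncomputable section

open Set MeasureTheory Filter Topology Function
open scoped ENNReal NNReal
open Literature.Analysis.FluidPDE Literature.Analysis.FunctionSpaces

namespace Summit.NavierStokesRegularity.NavierStokesRegularity.Cruxes.AxisymmetricKatoGlobal.StrategistS19g16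

open Summit.NavierStokesRegularity.NavierStokesRegularity.Theses.AxisymmetricExtremality
open Summit.NavierStokesRegularity.NavierStokesRegularity.Theorems.AxisymmetricKatoGlobal

/-! ## §W — the weakest drop-in replacement of the crux -/

/-- **W0**: no Rusin–Šverák minimal blow-up datum is axisymmetric (the threshold instance of the
crux — the only instance `closes` consumes). -/
def NoAxisymMinimalBlowupDatum : Prop :=
  ∀ ν : ℝ, 0 < ν → ∀ (u₀ : EuclideanSpace ℝ (Fin 3) → EuclideanSpace ℝ (Fin 3))
    (g : HomSobolev (EuclideanSpace ℝ (Fin 3)) (EuclideanSpace ℂ (Fin 3)) (1 / 2 : ℝ)),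
    IsMinimalBlowupDatum ν u₀ g → IsAxisymmetric u₀ → False

/-- Re-glue: W0 replaces the crux in the route's deciding theorem (pure logic). -/
theorem closes_of_noAxisymMinimal (h₂ : MinimalDatumPFold) (h₄ : PFoldToAxisymmetric)
    (hW : NoAxisymMinimalBlowupDatum) : _root_.NavierStokesRegularity := by
  show Literature.NS.NavierStokesExistenceSmoothR3
  intro ν hν u₀ hsm hdiv hdec
  by_contra hno
  obtain ⟨u₁, g, hmin, hax⟩ := h₄ ν hν (h₂ ν hν ⟨u₀, hsm, hdiv, hdec, hno⟩)
  exact hW ν hν u₁ g hmin (fun θ x => hax θ x)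

/-- W0 is formally weaker than the crux. -/
theorem noAxisymMinimal_of_crux (h : AxisymmetricKatoGlobal) : NoAxisymMinimalBlowupDatum := by
  intro ν hν u₀ g hmin hax
  obtain ⟨hL3, hrep, hdiv, -, hnot⟩ := hmin
  exact hnot (h ν hν u₀ g hL3 hrep hdiv (fun θ x => hax θ x))

/-! ## §W' — the O(2) stratum of W0 is a theorem -/

/-- Mirror across the meridional plane `{x₁ = 0}`: `σ (x₀, x₁, x₂) = (x₀, −x₁, x₂)`. -/
def mirrorY (x : EuclideanSpace ℝ (Fin 3)) : EuclideanSpace ℝ (Fin 3) :=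
  WithLp.toLp 2 ![x 0, -x 1, x 2]

@[simp] theorem mirrorY_apply_zero (x : EuclideanSpace ℝ (Fin 3)) : mirrorY x 0 = x 0 := rfl
@[simp] theorem mirrorY_apply_one (x : EuclideanSpace ℝ (Fin 3)) : mirrorY x 1 = -x 1 := rfl
@[simp] theorem mirrorY_apply_two (x : EuclideanSpace ℝ (Fin 3)) : mirrorY x 2 = x 2 := rfl

/-- A vector field is *mirror-symmetric* if it is equivariant under `σ`: `u (σ x) = σ (u x)`.
Together with axisymmetry this is `O(2)`-symmetry about the `x₂`-axis. -/
def IsMirrorSymmetric (u : EuclideanSpace ℝ (Fin 3) → EuclideanSpace ℝ (Fin 3)) : Prop :=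
  ∀ x, u (mirrorY x) = mirrorY (u x)

/-- The swirl is odd under the mirror: `Γ (σ x) = −Γ (x)` for a mirror-symmetric field. -/
theorem swirl_mirrorY {u : EuclideanSpace ℝ (Fin 3) → EuclideanSpace ℝ (Fin 3)}
    (hm : IsMirrorSymmetric u) (x : EuclideanSpace ℝ (Fin 3)) :
    swirl u (mirrorY x) = -swirl u x := by
  simp only [swirl, hm x, mirrorY_apply_zero, mirrorY_apply_one]
  ring

/-- Every point is carried to its mirror image by a rotation about the axis
(`θ = −2·arg (x₀ + i x₁)`; written with `cos θ = (x₀² − x₁²)/r²`, `sin θ = −2 x₀ x₁/r²`). -/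
theorem exists_rotZ_eq_mirrorY (x : EuclideanSpace ℝ (Fin 3)) : ∃ θ : ℝ, rotZ θ x = mirrorY x := by
  by_cases h0 : x 0 = 0 ∧ x 1 = 0
  · refine ⟨0, ?_⟩
    ext i
    fin_cases i <;> simp [h0.1, h0.2]
  · have hr : 0 < x 0 ^ 2 + x 1 ^ 2 := by
      rcases not_and_or.mp h0 with h | h
      · have := sq_pos_of_ne_zero h; positivity
      · have := sq_pos_of_ne_zero h; positivity
    set z : ℂ := ⟨x 0 ^ 2 - x 1 ^ 2, -(2 * x 0 * x 1)⟩ with hz_def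
    have hz_norm : ‖z‖ = x 0 ^ 2 + x 1 ^ 2 := by
      rw [Complex.norm_eq_sqrt_sq_add_sq]
      have : z.re ^ 2 + z.im ^ 2 = (x 0 ^ 2 + x 1 ^ 2) ^ 2 := by
        simp only [hz_def]; ring
      rw [this, Real.sqrt_sq hr.le]
    have hz : z ≠ 0 := by
      intro h
      rw [h, norm_zero] at hz_norm
      linarith
    have hc : Real.cos (Complex.arg z) = (x 0 ^ 2 - x 1 ^ 2) / (x 0 ^ 2 + x 1 ^ 2) := by
      rw [Complex.cos_arg hz, hz_norm]
    have hs : Real.sin (Complex.arg z) = -(2 * x 0 * x 1) / (x 0 ^ 2 + x 1 ^ 2) := by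
      rw [Complex.sin_arg, hz_norm]
    refine ⟨Complex.arg z, ?_⟩
    have hne : x 0 ^ 2 + x 1 ^ 2 ≠ 0 := hr.ne'
    have e0 : rotZ (Complex.arg z) x 0 = mirrorY x 0 := by
      rw [rotZ_apply_zero, mirrorY_apply_zero, hc, hs, div_mul_eq_mul_div, div_mul_eq_mul_div,
        ← sub_div, div_eq_iff hne]
      ring
    have e1 : rotZ (Complex.arg z) x 1 = mirrorY x 1 := by
      rw [rotZ_apply_one, mirrorY_apply_one, hc, hs, div_mul_eq_mul_div, div_mul_eq_mul_div,
        ← add_div, div_eq_iff hne]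
      ring
    have e2 : rotZ (Complex.arg z) x 2 = mirrorY x 2 := rfl
    ext i
    fin_cases i
    exacts [e0, e1, e2]

/-- **O(2)-symmetric fields are swirl-free**: axisymmetric + mirror-symmetric ⇒ `Γ ≡ 0`. -/
theorem hasNoSwirl_of_isAxisymmetric_of_isMirrorSymmetric
    {u : EuclideanSpace ℝ (Fin 3) → EuclideanSpace ℝ (Fin 3)}
    (hax : IsAxisymmetric u) (hm : IsMirrorSymmetric u) : HasNoSwirl u := by
  intro x
  obtain ⟨θ, hθ⟩ := exists_rotZ_eq_mirrorY x
  have h1 := hax.swirl_rotZ θ x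
  rw [hθ, swirl_mirrorY hm] at h1
  linarith

/-- **The O(2) stratum of W0 is a theorem**: no minimal blow-up datum is O(2)-symmetric
(axisymmetric and mirror-symmetric), for every `ν > 0` — from the tree's swirl-free theorem. -/
theorem noO2MinimalBlowupDatum {ν : ℝ} (hν : 0 < ν)
    {u₀ : EuclideanSpace ℝ (Fin 3) → EuclideanSpace ℝ (Fin 3)}
    {g : HomSobolev (EuclideanSpace ℝ (Fin 3)) (EuclideanSpace ℂ (Fin 3)) (1 / 2 : ℝ)}
    (hmin : IsMinimalBlowupDatum ν u₀ g) (hax : IsAxisymmetric u₀) (hm : IsMirrorSymmetric u₀) :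
    False := by
  obtain ⟨hL3, -, hdiv, -, hnot⟩ := hmin
  exact hnot (NoSwirlStratum.hasGlobalKatoSolution_of_isAxisymmetric_hasNoSwirl_viscosity hν hL3
    hdiv hax (hasNoSwirl_of_isAxisymmetric_of_isMirrorSymmetric hax hm))

/-- Dihedral strengthening of the sibling crux `MinimalDatumPFold`: from the Clay failure at `ν`,
minimal blow-up data with `D_p`-symmetry (rotation by `2π/p` AND the mirror `σ`) for unboundedly
many `p`. (Typed for the record; NOT filed — `no_new_routes`.) -/
def MinimalDatumDihedralPFold : Prop :=
  ∀ ν : ℝ, 0 < ν → (∃ v₀ : EuclideanSpace ℝ (Fin 3) → EuclideanSpace ℝ (Fin 3),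
      ContDiff ℝ (⊤ : ℕ∞) v₀ ∧ NSWave0.IsDivFree v₀ ∧ HasRapidSpatialDecay v₀ ∧
      ¬ ∃ (u : ℝ → EuclideanSpace ℝ (Fin 3) → EuclideanSpace ℝ (Fin 3))
          (p : ℝ → EuclideanSpace ℝ (Fin 3) → ℝ), IsSmoothOnHalfSpace u ∧ IsSmoothOnHalfSpace p ∧
          IsNavierStokesSolution ν 0 v₀ u p ∧ HasBoundedEnergy u) →
    ∀ N : ℕ, ∃ p : ℕ, N ≤ p ∧ 2 ≤ p ∧
      ∃ (u₀ : EuclideanSpace ℝ (Fin 3) → EuclideanSpace ℝ (Fin 3))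
        (g : HomSobolev (EuclideanSpace ℝ (Fin 3)) (EuclideanSpace ℂ (Fin 3)) (1 / 2 : ℝ)),
        IsMinimalBlowupDatum ν u₀ g ∧
          (∀ x, u₀ (rotZ (2 * Real.pi / p) x) = rotZ (2 * Real.pi / p) (u₀ x)) ∧ IsMirrorSymmetric u₀

/-- Dihedral analogue of the PROVED item `PFoldToAxisymmetric`: `D_p`-symmetric minimal data for
unboundedly many `p` ⇒ an `O(2)`-symmetric minimal datum (same Rusin–Šverák compactness argument;
the mirror clause is closed under `Ḣ^{1/2}` limits). -/
def DihedralPFoldToO2 : Prop :=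
  ∀ ν : ℝ, 0 < ν → (∀ N : ℕ, ∃ p : ℕ, N ≤ p ∧ 2 ≤ p ∧
      ∃ (u₀ : EuclideanSpace ℝ (Fin 3) → EuclideanSpace ℝ (Fin 3))
        (g : HomSobolev (EuclideanSpace ℝ (Fin 3)) (EuclideanSpace ℂ (Fin 3)) (1 / 2 : ℝ)),
        IsMinimalBlowupDatum ν u₀ g ∧
          (∀ x, u₀ (rotZ (2 * Real.pi / p) x) = rotZ (2 * Real.pi / p) (u₀ x)) ∧
            IsMirrorSymmetric u₀) →
    ∃ (u₀ : EuclideanSpace ℝ (Fin 3) → EuclideanSpace ℝ (Fin 3))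
      (g : HomSobolev (EuclideanSpace ℝ (Fin 3)) (EuclideanSpace ℂ (Fin 3)) (1 / 2 : ℝ)),
      IsMinimalBlowupDatum ν u₀ g ∧ IsAxisymmetric u₀ ∧ IsMirrorSymmetric u₀

/-- **Dihedral re-glue decides the summit without the crux** (sorry-free): the crux
`AxisymmetricKatoGlobal` is replaced by the tree's swirl-free theorem. -/
theorem closes_dihedral (h₂ : MinimalDatumDihedralPFold) (h₄ : DihedralPFoldToO2) :
    _root_.NavierStokesRegularity := by
  show Literature.NS.NavierStokesExistenceSmoothR3
  intro ν hν u₀ hsm hdiv hdec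
  by_contra hno
  obtain ⟨u₁, g, hmin, hax, hm⟩ := h₄ ν hν (h₂ ν hν ⟨u₀, hsm, hdiv, hdec, hno⟩)
  exact noO2MinimalBlowupDatum hν hmin hax hm

/-! ## §D — the any-modulus decomposition D2 (assembly proved, both pieces open) -/

/-- **D2a (a-priori half)**: for a smooth axisymmetric Kato solution on `[0,T)` the swirl vanishes
at the axis UNIFORMLY up to the (possibly maximal) time `T` — with SOME modulus, no rate. -/
def SwirlVanishesAtAxis : Prop :=
  ∀ ν : ℝ, 0 < ν → ∀ T : ℝ, 0 < T →
    ∀ (u₀ : EuclideanSpace ℝ (Fin 3) → EuclideanSpace ℝ (Fin 3))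
      (g : HomSobolev (EuclideanSpace ℝ (Fin 3)) (EuclideanSpace ℂ (Fin 3)) (1 / 2 : ℝ))
      (u : ℝ → EuclideanSpace ℝ (Fin 3) → EuclideanSpace ℝ (Fin 3)),
      g.Represents (Literature.Analysis.FunctionSpaces.EuclideanSpace.complexify ∘ u₀) →
      IsKatoSolutionOn T ν u₀ u → ContDiffOn ℝ (⊤ : ℕ∞) (uncurry u) (Ioo 0 T ×ˢ univ) →
      (∀ t ∈ Ioo 0 T, IsAxisymmetric (u t)) →
      ∀ t₀ ∈ Ioo 0 T, ∀ ε : ℝ, 0 < ε → ∃ δ : ℝ, 0 < δ ∧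
        ∀ t ∈ Ico t₀ T, ∀ x : EuclideanSpace ℝ (Fin 3), cylRadius x ≤ δ → |swirl (u t) x| ≤ ε

/-- **D2b (criterion half, "modulus upgrade")**: uniform vanishing of `Γ` at the axis upgrades to
the `|log r|⁻³` modulus of the registered stub `stub_swirlAxisModulus` (an improvement-of-modulus
statement for the swirl equation `∂ₜΓ + b·∇Γ = ΔΓ − (2/r)∂ᵣΓ` along NS drifts). -/
def SwirlModulusUpgrade : Prop :=
  ∀ ν : ℝ, 0 < ν → ∀ T : ℝ, 0 < T →
    ∀ (u₀ : EuclideanSpace ℝ (Fin 3) → EuclideanSpace ℝ (Fin 3))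
      (g : HomSobolev (EuclideanSpace ℝ (Fin 3)) (EuclideanSpace ℂ (Fin 3)) (1 / 2 : ℝ))
      (u : ℝ → EuclideanSpace ℝ (Fin 3) → EuclideanSpace ℝ (Fin 3)),
      g.Represents (Literature.Analysis.FunctionSpaces.EuclideanSpace.complexify ∘ u₀) →
      IsKatoSolutionOn T ν u₀ u → ContDiffOn ℝ (⊤ : ℕ∞) (uncurry u) (Ioo 0 T ×ˢ univ) →
      (∀ t ∈ Ioo 0 T, IsAxisymmetric (u t)) →
      (∀ t₀ ∈ Ioo 0 T, ∀ ε : ℝ, 0 < ε → ∃ δ : ℝ, 0 < δ ∧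
        ∀ t ∈ Ico t₀ T, ∀ x : EuclideanSpace ℝ (Fin 3), cylRadius x ≤ δ → |swirl (u t) x| ≤ ε) →
      ∀ t₀ ∈ Ioo 0 T, ∃ C δ₀ : ℝ, 0 < δ₀ ∧ δ₀ < 1 ∧
        ∀ t ∈ Ico t₀ T, ∀ x : EuclideanSpace ℝ (Fin 3), cylRadius x ≤ δ₀ →
          |swirl (u t) x| ≤ C / |Real.log (cylRadius x)| ^ 3

/-- **Assembly of D2 (proved)**: Seregin's log-swirl ε-regularity fact (named Literature fact, in-tree
discharge programme) + D2a + D2b ⇒ the crux, through the landed reduction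
`Registered.AxisymmetricKatoGlobal_of_logSwirlFacts` (p150628). -/
theorem crux_of_D2 (hS : seregin2022_logSwirl_regularAtOrigin) (ha : SwirlVanishesAtAxis)
    (hb : SwirlModulusUpgrade) : AxisymmetricKatoGlobal :=
  Registered.AxisymmetricKatoGlobal_of_logSwirlFacts hS
    (fun ν hν T hT u₀ g u hrep hK hC hax =>
      hb ν hν T hT u₀ g u hrep hK hC hax (ha ν hν T hT u₀ g u hrep hK hC hax))

/-! ## §S — the strengthening AX-L, typed as a signature only -/

/-- **AX-L** (KNSS Liouville conjecture, axisymmetric class WITH swirl): a bounded, smooth,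
axisymmetric ancient mild solution is constant. Typed abstractly over a predicate `IsAncientMild`
(the tree has no bounded-ancient-mild-solution notion yet; this is a SIGNATURE for the census, not
a claim, and no decl of the tree is asserted to satisfy it). -/
def AXLiouvilleShape
    (IsAncientMild : ℝ → (ℝ → EuclideanSpace ℝ (Fin 3) → EuclideanSpace ℝ (Fin 3)) → Prop) : Prop :=
  ∀ ν : ℝ, 0 < ν → ∀ U : ℝ → EuclideanSpace ℝ (Fin 3) → EuclideanSpace ℝ (Fin 3),
    IsAncientMild ν U → (∃ M : ℝ, ∀ t ≤ 0, ∀ x, ‖U t x‖ ≤ M) →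
    (∀ t ≤ 0, IsAxisymmetric (U t)) → ∃ c : EuclideanSpace ℝ (Fin 3), ∀ t ≤ 0, ∀ x, U t x = c

end Summit.NavierStokesRegularity.NavierStokesRegularity.Cruxes.AxisymmetricKatoGlobal.StrategistS19g16

end
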